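import Mathlib
import Summits.ResolutionOfSingularities.ResolutionOfSingularities.Theorems.HomologicalConductorSurfaceTerminationCubicConeCa
import Summits.ResolutionOfSingularities.ResolutionOfSingularities.Theorems.HomologicalConductorPersistenceKC3LocalModelCa
import Summits.ResolutionOfSingularities.ResolutionOfSingularities.Theorems.HomologicalConductorSurfaceTerminationResidualCriterion
import Summits.ResolutionOfSingularities.ResolutionOfSingularities.Theorems.HomologicalConductorSurfaceTerminationReduction
import Summits.ResolutionOfSingularities.ResolutionOfSingularities.Theorems.HomologicalConductorNoZenoCapture
import HarnessLib

/-!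
# Kill test `SurfaceTermination` (stmt-ResolutionOfSingularities-16488), (R-QH) «CUBIC CONE EXIT», part 2:
# the (E) INITIAL PAIR at stage 0 and the EXIT of the `ca`-tower of the cubic cone along its weight valuation

Route `ResolutionOfSingularities/HomologicalConductor` (cell `res-hironaka`, chain W4.4), kill test `SurfaceTermination`
(stmt-16488), residue stub `stub_initialPairOfConstantGenus` ((E)-form, registry r8 c2da4ae6bde8d476); res-L0-w44-plan-1
CHAIN v21 (ρ35e) standing offer **(R-QH)** («QH rung of the residue … simple-elliptic cone ↦ exit»), res-D-pv-045 g7.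
OURS; AI-written, weaker than expert review; nothing here is a statement of the manuscript under review (Hironaka 2017)
and no statement of it is used; no theorem here concludes the kill test or the crux (one datum `(A, O)` only).

SETTING (the kill test's own `NoZeno.Birth.ca / loc / chart / nrm / tower`). Fields `k ⊆ K`, `x y z : K` with **`hker`**:
the kernel of `k[X₀,X₁,X₂] → K`, `Xᵢ ↦ x, y, z` is EXACTLY `(f)`, `f = X₀²X₁ + X₁²X₂ + X₂²X₀`, so `A := range = k[x,y,z]`
is the cubic cone (`Ẽ₆` for `char k ≠ 3`); `O ∋ k` a valuation ring of `K` with `O.valuation x < 1` and the **WEIGHT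
property `hW`**: `O.valuation (F(x,y,z)) = (O.valuation x)ᵈ` for every form `F` of degree `d` with `F(x,y,z) ≠ 0`.
RESULTS (`T₀ = tower O A 0 = loc O A`; `g₀ = x² + 2yz = ∂f/∂y`, `g₁ = y² + 2zx = ∂f/∂z`), every field `k`:
* §1 bookkeeping; the ruling `(T,0,0)` reads the form `Σ aᵢ G₁ⁱ G₀ⁿ⁻ⁱ` as `a₀ T²ⁿ`, whence **`t = g₁ g₀⁻¹` is
  transcendental over `k`** (`eq_zero_of_aeval_ratio_eq_zero`) and `v(P(t)) = 1` for `P ≠ 0` (`hW` in degree `2n`);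
* §2 through the local model `e : ↥(loc O A) ≃+* k[X]_𝔪 ⧸ (f)` (res-type-010's `KC3Upper.exists_locModelEquiv`, p533351):
  FLOOR `quadric_mem_ca_loc` (`g₀, g₁ ∈ ca T₀`, part 1) and CEILING `valuation_le_of_mem_ca_loc` (`c ∈ ca T₀ ⇒ v(c) ≤ v(x)²`,
  part 1's `ca ⊆ 𝔪²`), so `g₀` has MINIMAL value on `ca T₀` (`mul_inv_mem_of_mem_ca_loc`);
* §3 **`initialPair_cubicCone`** — the conclusion of `stub_initialPairOfConstantGenus` AT STAGE `m' = 0` for this datum;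
* §4 **`exists_isRegularLocalRing_tower_cubicCone`** — with the kill test's remaining binders (`CharP k p`,
  `IsFractionRing ↥A K`, `ringKrullDim ↥A = 2`): **`∃ m, IsRegularLocalRing ↥(tower O A m)`** via LEMMA E in tower form
  (`NoZeno.SandwichCluster.mul_inv_mem_chart`, `chart_le_loc_nrm_chart`, res-L0-w44's residual criterion
  `Regimes.exists_regular_of_residually_transcendental_mem_tower`): THE CONE EXITS.
Kernel form of the paper-decided class «simple elliptic cone ↦ exit» (res-L0-w44-lead-1 K44S-NONRATIONAL §4 (4a)/(4b),
refereed by res-L0-w44-tri-1), `e = 3`, in the residue's own (E)-currency. References (mechanism only): S. B. Iyengar,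
R. Takahashi, IMRN 2016 §2 [`IyengarTakahashi2014`].
-/

noncomputable section
noncomputable section

-- single-problem summit: the doubled namespace component `ResolutionOfSingularities` is forced
set_option linter.dupNamespace false

namespace Summit.ResolutionOfSingularities.ResolutionOfSingularities.Theorems.SurfaceTermination.CubicCone

open MvPolynomial
open Literature.RingTheory.CohomologyAnnihilator (cohomologyAnnihilator cohomologyAnnihilatorOfDegree
  ringEquiv_apply_mem_cohomologyAnnihilatorOfDegree mem_cohomologyAnnihilator_iff cohomologyAnnihilatorOfDegree_le)
open Literature.AlgebraicGeometry.Resolution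
open Summit.ResolutionOfSingularities.ResolutionOfSingularities.Theorems.NoZeno.Birth
open Summit.ResolutionOfSingularities.ResolutionOfSingularities.Theorems.HomologicalConductor
open Summit.ResolutionOfSingularities.ResolutionOfSingularities.Theorems.HomologicalConductor.PersistenceKC3Tower

variable {k K : Type} [Field k] [Field K] [Algebra k K]

/-! ## §1 Bookkeeping: non-membership in `(f)`, the ruling `(T,0,0)`, values at the vertex -/

/-- A polynomial `F` with `F(v) ≠ 0` at a `k`-point `v` of the cone (`f(v) = 0`) is not a multiple of `f`. [folklore] -/
theorem not_mem_span_f_of_eval (v : Fin 3 → k)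
    (hfv : MvPolynomial.eval v (X 0 ^ 2 * X 1 + X 1 ^ 2 * X 2 + X 2 ^ 2 * X 0 : MvPolynomial (Fin 3) k) = 0)
    {F : MvPolynomial (Fin 3) k} (hF : MvPolynomial.eval v F ≠ 0) :
    F ∉ Ideal.span ({X 0 ^ 2 * X 1 + X 1 ^ 2 * X 2 + X 2 ^ 2 * X 0} : Set (MvPolynomial (Fin 3) k)) := by
  intro h
  obtain ⟨q, rfl⟩ := Ideal.mem_span_singleton'.mp h
  exact hF (by rw [map_mul, hfv, mul_zero])

/-- The quadric `Xᵢ² + 2 Xⱼ Xₗ` is a form of degree `2`. [folklore] -/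
theorem isHomogeneous_quadric (i j l : Fin 3) : (X i ^ 2 + 2 * X j * X l : MvPolynomial (Fin 3) k).IsHomogeneous 2 := by
  have h : (X i ^ 2 + C 2 * X j * X l : MvPolynomial (Fin 3) k).IsHomogeneous 2 :=
    (isHomogeneous_X_pow i 2).add (((isHomogeneous_X k j).C_mul 2).mul (isHomogeneous_X k l))
  rwa [map_ofNat] at h

/-- Along the ruling `(T,0,0)` the binary form `Σᵢ aᵢ G₁ⁱ G₀ⁿ⁻ⁱ` (`G₀ = X₀² + 2X₁X₂ ↦ T²`, `G₁ = X₁² + 2X₂X₀ ↦ 0`)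
reads `a₀·T²ⁿ`; so if it lies in `(f)` (`f ↦ 0`) then `a₀ = 0`. [folklore] -/
theorem coeff_zero_eq_zero_of_form_mem_span (P : Polynomial k) (n : ℕ)
    (h : (∑ i ∈ Finset.range (n + 1), C (P.coeff i) * (X 1 ^ 2 + 2 * X 2 * X 0) ^ i *
        (X 0 ^ 2 + 2 * X 1 * X 2) ^ (n - i) : MvPolynomial (Fin 3) k) ∈
      Ideal.span ({X 0 ^ 2 * X 1 + X 1 ^ 2 * X 2 + X 2 ^ 2 * X 0} : Set (MvPolynomial (Fin 3) k))) :
    P.coeff 0 = 0 := by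
  obtain ⟨q, hq⟩ := Ideal.mem_span_singleton'.mp h
  have hev := congrArg (MvPolynomial.aeval (R := k) (![Polynomial.X, 0, 0] : Fin 3 → Polynomial k)) hq
  have hf0 : MvPolynomial.aeval (R := k) (![Polynomial.X, 0, 0] : Fin 3 → Polynomial k)
      (X 0 ^ 2 * X 1 + X 1 ^ 2 * X 2 + X 2 ^ 2 * X 0) = 0 := by simp
  have hG0 : MvPolynomial.aeval (R := k) (![Polynomial.X, 0, 0] : Fin 3 → Polynomial k)
      (X 0 ^ 2 + 2 * X 1 * X 2) = Polynomial.X ^ 2 := by simp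
  have hG1 : MvPolynomial.aeval (R := k) (![Polynomial.X, 0, 0] : Fin 3 → Polynomial k)
      (X 1 ^ 2 + 2 * X 2 * X 0) = 0 := by simp
  rw [map_mul, hf0, mul_zero, map_sum] at hev
  simp only [map_mul, map_pow, MvPolynomial.aeval_C, Polynomial.algebraMap_eq, hG0, hG1] at hev
  rw [Finset.sum_eq_single 0 (fun i _ hi => by rw [zero_pow hi, mul_zero, zero_mul]) (by simp)] at hev
  simp only [pow_zero, mul_one, Nat.sub_zero] at hev
  have h2 : (Polynomial.C (P.coeff 0) * (Polynomial.X ^ 2) ^ n).coeff (2 * n) = 0 := by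
    rw [← hev, Polynomial.coeff_zero]
  rwa [← pow_mul, Polynomial.coeff_C_mul_X_pow, if_pos rfl] at h2

section Cone

variable {x y z : K}
  (hker : RingHom.ker (MvPolynomial.aeval (R := k) (![x, y, z] : Fin 3 → K)).toRingHom =
    Ideal.span {X 0 ^ 2 * X 1 + X 1 ^ 2 * X 2 + X 2 ^ 2 * X 0})
include hker

/-- Under `hker`: `F(v) ≠ 0` at a `k`-point `v` of the cone gives `F(x,y,z) ≠ 0`. [folklore] -/
theorem aeval_ne_zero_of_eval (v : Fin 3 → k)
    (hfv : MvPolynomial.eval v (X 0 ^ 2 * X 1 + X 1 ^ 2 * X 2 + X 2 ^ 2 * X 0 : MvPolynomial (Fin 3) k) = 0)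
    {F : MvPolynomial (Fin 3) k} (hF : MvPolynomial.eval v F ≠ 0) : MvPolynomial.aeval ![x, y, z] F ≠ 0 := by
  intro h0
  have hmem : F ∈ RingHom.ker (MvPolynomial.aeval (R := k) (![x, y, z] : Fin 3 → K)).toRingHom := h0
  rw [hker] at hmem
  exact not_mem_span_f_of_eval v hfv hF hmem

/-- `x, y, z ≠ 0` on the cone (`Xᵢ ∉ (f)`: evaluate at the coordinate points). [folklore] -/
theorem coord_ne_zero (i : Fin 3) : (![x, y, z] : Fin 3 → K) i ≠ 0 := by
  have h := aeval_ne_zero_of_eval hker (Pi.single i 1) (by fin_cases i <;> simp) (F := X i) (by simp)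
  rwa [MvPolynomial.aeval_X] at h

/-- `g₀ = x² + 2yz ≠ 0` on the cone (`X₀² + 2X₁X₂` is `1` at `(1:0:0)`). [folklore] -/
theorem quadric_ne_zero : x ^ 2 + 2 * y * z ≠ 0 := by
  have h := aeval_ne_zero_of_eval hker ![1, 0, 0] (by simp) (F := X 0 ^ 2 + 2 * X 1 * X 2) (by simp)
  simpa using h

/-- `g₁ = y² + 2zx ≠ 0` on the cone (the form `X₁² + 2X₂X₀` is `1` at `(0:1:0)`). [folklore] -/
theorem quadric'_ne_zero : y ^ 2 + 2 * z * x ≠ 0 := by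
  have h := aeval_ne_zero_of_eval hker ![0, 1, 0] (by simp) (F := X 1 ^ 2 + 2 * X 2 * X 0) (by simp)
  simpa using h

/-- `g₀ⁿ · P(g₁ g₀⁻¹) = (Σᵢ aᵢ G₁ⁱ G₀ⁿ⁻ⁱ)(x,y,z)` for `deg P ≤ n` (clearing denominators). [folklore] -/
theorem aeval_form_eq (P : Polynomial k) (n : ℕ) (hn : P.natDegree ≤ n) :
    MvPolynomial.aeval ![x, y, z] (∑ i ∈ Finset.range (n + 1), C (P.coeff i) * (X 1 ^ 2 + 2 * X 2 * X 0) ^ i *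
        (X 0 ^ 2 + 2 * X 1 * X 2) ^ (n - i) : MvPolynomial (Fin 3) k) =
      (x ^ 2 + 2 * y * z) ^ n * Polynomial.aeval ((y ^ 2 + 2 * z * x) * (x ^ 2 + 2 * y * z)⁻¹) P := by
  have hg0 : (x ^ 2 + 2 * y * z) ≠ 0 := quadric_ne_zero hker
  rw [Polynomial.aeval_eq_sum_range' (Nat.lt_succ_of_le hn), map_sum, Finset.mul_sum]
  refine Finset.sum_congr rfl fun i hi => ?_
  have hi' : i ≤ n := Nat.lt_succ_iff.mp (Finset.mem_range.mp hi)
  simp only [map_mul, map_pow, map_add, map_ofNat, MvPolynomial.aeval_C, MvPolynomial.aeval_X, Matrix.cons_val_zero,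
    Matrix.cons_val_one, Matrix.cons_val_two, Matrix.tail_cons, Matrix.head_cons]
  rw [Algebra.smul_def, mul_pow, inv_pow, pow_sub₀ _ hg0 hi']
  ring

/-- **`t = g₁·g₀⁻¹` is transcendental over `k`**: `P(t) = 0 ⇒ P = 0` (ruling `(T,0,0)`: `a₀ = 0`, so `P = X·P'`,
and `t ≠ 0`; induction on `deg P`). [OURS · W4.4 kill test] -/
theorem eq_zero_of_aeval_ratio_eq_zero (n : ℕ) :
    ∀ P : Polynomial k, P.natDegree ≤ n →
      Polynomial.aeval ((y ^ 2 + 2 * z * x) * (x ^ 2 + 2 * y * z)⁻¹) P = 0 → P = 0 := by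
  have ht0 : (y ^ 2 + 2 * z * x) * (x ^ 2 + 2 * y * z)⁻¹ ≠ 0 :=
    mul_ne_zero (quadric'_ne_zero hker) (inv_ne_zero (quadric_ne_zero hker))
  have h0 : ∀ (P : Polynomial k) (n : ℕ), P.natDegree ≤ n →
      Polynomial.aeval ((y ^ 2 + 2 * z * x) * (x ^ 2 + 2 * y * z)⁻¹) P = 0 → P.coeff 0 = 0 := by
    intro P n hn hP
    apply coeff_zero_eq_zero_of_form_mem_span P n
    rw [← hker]
    change MvPolynomial.aeval (R := k) (![x, y, z] : Fin 3 → K) _ = 0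
    rw [aeval_form_eq hker P n hn, hP, mul_zero]
  induction n with
  | zero =>
    intro P hn hP
    rw [Polynomial.eq_C_of_natDegree_le_zero hn, h0 P 0 hn hP, map_zero]
  | succ n ih =>
    intro P hn hP
    obtain ⟨P', rfl⟩ := Polynomial.X_dvd_iff.mpr (h0 P (n + 1) hn hP)
    by_cases hP' : P' = 0
    · rw [hP', mul_zero]
    have hdeg : P'.natDegree ≤ n := by have h := Polynomial.natDegree_X_mul hP'; omega
    rw [map_mul, Polynomial.aeval_X, mul_eq_zero] at hP
    rcases hP with h | h
    · exact absurd h ht0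
    · rw [ih P' hdeg h, mul_zero]

variable {O : ValuationSubring K}
  (hW : ∀ (d : ℕ) (F : MvPolynomial (Fin 3) k), F.IsHomogeneous d → MvPolynomial.aeval ![x, y, z] F ≠ 0 →
    O.valuation (MvPolynomial.aeval ![x, y, z] F) = O.valuation x ^ d)
include hW

/-- Under the weight property every coordinate has the value of `x`: `v(y) = v(z) = v(x)`. [folklore] -/
theorem valuation_coord_eq (i : Fin 3) : O.valuation ((![x, y, z] : Fin 3 → K) i) = O.valuation x := by
  have h := hW 1 (X i) (isHomogeneous_X k i) (by rw [MvPolynomial.aeval_X]; exact coord_ne_zero hker i)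
  rwa [MvPolynomial.aeval_X, pow_one] at h

/-- `v(g₀) = v(x)²` (`g₀ = x² + 2yz` is a non-vanishing quadratic form). [folklore] -/
theorem valuation_quadric_eq : O.valuation (x ^ 2 + 2 * y * z) = O.valuation x ^ 2 := by
  have h := hW 2 _ (isHomogeneous_quadric 0 1 2) (aeval_ne_zero_of_eval hker ![1, 0, 0] (by simp) (by simp))
  simpa using h

/-- **`v(P(t)) = 1` for every non-zero `P ∈ k[X]`**, `t = g₁·g₀⁻¹`: `g₀ⁿ·P(t) ≠ 0` is the value of a form of degree `2n`,
so `v(x)²ⁿ · v(P(t)) = v(x)²ⁿ`. [OURS · W4.4 kill test] -/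
theorem valuation_aeval_ratio_eq_one {P : Polynomial k} (hP : P ≠ 0) :
    O.valuation (Polynomial.aeval ((y ^ 2 + 2 * z * x) * (x ^ 2 + 2 * y * z)⁻¹) P) = 1 := by
  set n := P.natDegree
  have hne : Polynomial.aeval ((y ^ 2 + 2 * z * x) * (x ^ 2 + 2 * y * z)⁻¹) P ≠ 0 :=
    fun h => hP (eq_zero_of_aeval_ratio_eq_zero hker n P le_rfl h)
  have hform : (∑ i ∈ Finset.range (n + 1), C (P.coeff i) * (X 1 ^ 2 + 2 * X 2 * X 0) ^ i *
      (X 0 ^ 2 + 2 * X 1 * X 2) ^ (n - i) : MvPolynomial (Fin 3) k).IsHomogeneous (2 * n) := by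
    refine IsHomogeneous.sum _ _ _ fun i hi => ?_
    have hi' : i ≤ n := Nat.lt_succ_iff.mp (Finset.mem_range.mp hi)
    have hdeg : 0 + 2 * i + 2 * (n - i) = 2 * n := by omega
    exact hdeg ▸ (((isHomogeneous_C _ _).mul ((isHomogeneous_quadric 1 2 0).pow i)).mul
      ((isHomogeneous_quadric 0 1 2).pow (n - i)))
  have hne2 : MvPolynomial.aeval ![x, y, z] (∑ i ∈ Finset.range (n + 1), C (P.coeff i) *
      (X 1 ^ 2 + 2 * X 2 * X 0) ^ i * (X 0 ^ 2 + 2 * X 1 * X 2) ^ (n - i) : MvPolynomial (Fin 3) k) ≠ 0 := by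
    rw [aeval_form_eq hker P n le_rfl]
    exact mul_ne_zero (pow_ne_zero _ (quadric_ne_zero hker)) hne
  have hval := hW (2 * n) _ hform hne2
  rw [aeval_form_eq hker P n le_rfl, map_mul, map_pow, valuation_quadric_eq hker hW, ← pow_mul] at hval
  have h0 : O.valuation x ^ (2 * n) ≠ 0 := pow_ne_zero _ (by rw [Ne, Valuation.zero_iff]; exact coord_ne_zero hker 0)
  exact mul_left_cancel₀ h0 (by rw [hval, mul_one])

variable (hx : O.valuation x < 1)
include hx

/-- The centre of `O` on `A = k[x,y,z]` is the vertex: `v(x), v(y), v(z) < 1`. [folklore] -/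
theorem valuation_coord_lt_one (i : Fin 3) : O.valuation ((![x, y, z] : Fin 3 → K) i) < 1 := by
  rw [valuation_coord_eq hker hW]; exact hx

variable (hk : ∀ c : k, algebraMap k K c ∈ O)
include hk

/-- `v(p(x,y,z)) ≤ v(x)` for `p ∈ 𝔪 = (X₀, X₁, X₂)`. [folklore] -/
theorem valuation_aeval_le_of_mem_idealOfVars {p : MvPolynomial (Fin 3) k} (hp : p ∈ idealOfVars (Fin 3) k) :
    O.valuation (MvPolynomial.aeval ![x, y, z] p) ≤ O.valuation x := by
  induction hp using Submodule.span_induction with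
  | mem p hp =>
    obtain ⟨i, rfl⟩ := hp
    rw [MvPolynomial.aeval_X, valuation_coord_eq hker hW i]
  | zero => simp
  | add p q _ _ hp hq => rw [map_add]; exact Valuation.map_add_le _ hp hq
  | smul r p _ hp =>
    rw [smul_eq_mul, map_mul, map_mul]
    have hr : O.valuation (MvPolynomial.aeval ![x, y, z] r) ≤ 1 := (O.valuation_le_one_iff _).mpr
      (KC3Upper.aeval_mem_valuationSubring _ O hk (valuation_coord_lt_one hker hW hx) r)
    calc O.valuation (MvPolynomial.aeval ![x, y, z] r) * O.valuation (MvPolynomial.aeval ![x, y, z] p)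
        ≤ 1 * O.valuation x := mul_le_mul' hr hp
      _ = O.valuation x := one_mul _

/-- `v(p(x,y,z)) ≤ v(x)²` for `p ∈ 𝔪²`. [folklore] -/
theorem valuation_aeval_le_of_mem_sq {p : MvPolynomial (Fin 3) k} (hp : p ∈ idealOfVars (Fin 3) k ^ 2) :
    O.valuation (MvPolynomial.aeval ![x, y, z] p) ≤ O.valuation x ^ 2 := by
  rw [pow_two] at hp
  refine Submodule.mul_induction_on hp (fun a ha b hb => ?_) (fun a b ha hb => ?_)
  · rw [map_mul, map_mul, pow_two]
    exact mul_le_mul' (valuation_aeval_le_of_mem_idealOfVars hker hW hx hk ha)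
      (valuation_aeval_le_of_mem_idealOfVars hker hW hx hk hb)
  · rw [map_add]; exact Valuation.map_add_le _ ha hb

/-! ## §2 Through the local model: floor and ceiling at `T₀ = loc O A` -/

/-- **The local model of `T₀`**: `e : ↥(loc O A) ≃+* k[x,y,z]_𝔪 ⧸ (f)`, `e ⟨p(x,y,z), _⟩ = (p/1)‾` (res-type-010's
`KC3Upper.exists_locModelEquiv` composed with `hker`). [folklore] -/
theorem exists_coneLocModelEquiv :
    ∃ e : ↥(loc O (MvPolynomial.aeval (R := k) (![x, y, z] : Fin 3 → K)).range) ≃+*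
        (Localization.AtPrime (originIdeal k 3) ⧸ Ideal.span {algebraMap (MvPolynomial (Fin 3) k)
          (Localization.AtPrime (originIdeal k 3)) (X 0 ^ 2 * X 1 + X 1 ^ 2 * X 2 + X 2 ^ 2 * X 0)}),
      ∀ (p : MvPolynomial (Fin 3) k)
        (hp : MvPolynomial.aeval ![x, y, z] p ∈ loc O (MvPolynomial.aeval (R := k) (![x, y, z] : Fin 3 → K)).range),
        e ⟨MvPolynomial.aeval ![x, y, z] p, hp⟩ =
          Ideal.Quotient.mk _ (algebraMap (MvPolynomial (Fin 3) k) (Localization.AtPrime (originIdeal k 3)) p) := by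
  obtain ⟨e, he⟩ := KC3Upper.exists_locModelEquiv (![x, y, z] : Fin 3 → K) O hk (valuation_coord_lt_one hker hW hx)
  have hmap : (RingHom.ker (MvPolynomial.aeval (R := k) (![x, y, z] : Fin 3 → K)).toRingHom).map
      (algebraMap (MvPolynomial (Fin 3) k) (Localization.AtPrime (originIdeal k 3))) =
      Ideal.span {algebraMap (MvPolynomial (Fin 3) k) (Localization.AtPrime (originIdeal k 3))
        (X 0 ^ 2 * X 1 + X 1 ^ 2 * X 2 + X 2 ^ 2 * X 0)} := by
    rw [hker, Ideal.map_span, Set.image_singleton]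
  refine ⟨e.trans (Ideal.quotEquivOfEq hmap), fun p hp => ?_⟩
  rw [RingEquiv.trans_apply, he p hp, Ideal.quotEquivOfEq_mk]

omit hker hW hx hk in
/-- `p(x,y,z) ∈ loc O A` for every polynomial `p` (`A ≤ loc O A`). [folklore] -/
theorem aeval_mem_loc (O : ValuationSubring K) (p : MvPolynomial (Fin 3) k) :
    MvPolynomial.aeval ![x, y, z] p ∈ loc O (MvPolynomial.aeval (R := k) (![x, y, z] : Fin 3 → K)).range :=
  KC3Upper.mem_loc_of_mem O _ ⟨p, rfl⟩

/-- **FLOOR AT `T₀` (OURS · W4.4 (R-QH)).** The Jacobian quadrics `2xy + z²`, `x² + 2yz`, `y² + 2zx` lie in the route's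
set-valued `ca (loc O A)`: part 1's `mk_algebraMap_quadric_mem_cohomologyAnnihilatorOfDegree_three` along `e.symm`.
[OURS · W4.4 kill test] -/
theorem quadric_mem_ca_loc (i : Fin 3) :
    MvPolynomial.aeval ![x, y, z] ((![2 * X 0 * X 1 + X 2 ^ 2, X 0 ^ 2 + 2 * X 1 * X 2, X 1 ^ 2 + 2 * X 2 * X 0] :
        Fin 3 → MvPolynomial (Fin 3) k) i) ∈
      ca (loc O (MvPolynomial.aeval (R := k) (![x, y, z] : Fin 3 → K)).range) := by
  obtain ⟨e, he⟩ := exists_coneLocModelEquiv hker hW hx hk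
  have hmodel := mk_algebraMap_quadric_mem_cohomologyAnnihilatorOfDegree_three k (originIdeal k 3) rfl i
  have h3 := ringEquiv_apply_mem_cohomologyAnnihilatorOfDegree
    (S := ↥(loc O (MvPolynomial.aeval (R := k) (![x, y, z] : Fin 3 → K)).range)) e.symm hmodel
  have hsymm : e.symm (Ideal.Quotient.mk _ (algebraMap (MvPolynomial (Fin 3) k) (Localization.AtPrime (originIdeal k 3))
      ((![2 * X 0 * X 1 + X 2 ^ 2, X 0 ^ 2 + 2 * X 1 * X 2, X 1 ^ 2 + 2 * X 2 * X 0] :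
        Fin 3 → MvPolynomial (Fin 3) k) i))) =
      ⟨MvPolynomial.aeval ![x, y, z] ((![2 * X 0 * X 1 + X 2 ^ 2, X 0 ^ 2 + 2 * X 1 * X 2, X 1 ^ 2 + 2 * X 2 * X 0] :
        Fin 3 → MvPolynomial (Fin 3) k) i), aeval_mem_loc O _⟩ := by
    rw [RingEquiv.symm_apply_eq, he]
  rw [hsymm] at h3
  have hu := cohomologyAnnihilatorOfDegree_le 3 h3
  have hmem := Set.mem_image_of_mem ((↑) : ↥(loc O (MvPolynomial.aeval (R := k) (![x, y, z] : Fin 3 → K)).range) → K) hu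
  rw [Subalgebra.image_coe_cohomologyAnnihilator] at hmem
  exact hmem

/-- **CEILING AT `T₀` (OURS · W4.4 (R-QH)).** Every `c ∈ ca (loc O A)` has `v(c) ≤ v(x)²`: `c = a·s⁻¹` with `a = p(x,y,z)`,
`s = q(x,y,z)` an `O`-unit; `a = c·s ∈ caⁿ(↥T₀)`, `e` sends it to `(p/1)‾ ∈ caⁿ(k[X]_𝔪 ⧸ (f))`, so `p ∈ 𝔪²` (part 1) and
`v(a) ≤ v(x)²` (§1). [OURS · W4.4 kill test] -/
theorem valuation_le_of_mem_ca_loc {c : K}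
    (hc : c ∈ ca (loc O (MvPolynomial.aeval (R := k) (![x, y, z] : Fin 3 → K)).range)) :
    O.valuation c ≤ O.valuation x ^ 2 := by
  obtain ⟨e, he⟩ := exists_coneLocModelEquiv hker hW hx hk
  have himg : c ∈ ((↑) : ↥(loc O (MvPolynomial.aeval (R := k) (![x, y, z] : Fin 3 → K)).range) → K) ''
      (cohomologyAnnihilator ↥(loc O (MvPolynomial.aeval (R := k) (![x, y, z] : Fin 3 → K)).range) :
        Set ↥(loc O (MvPolynomial.aeval (R := k) (![x, y, z] : Fin 3 → K)).range)) := by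
    rw [Subalgebra.image_coe_cohomologyAnnihilator]; exact hc
  obtain ⟨u, hu, rfl⟩ := himg
  obtain ⟨n, hn⟩ := mem_cohomologyAnnihilator_iff.mp hu
  obtain ⟨a, ha, s, hs, hsO, hus⟩ := (mem_loc_iff O _).mp u.2
  obtain ⟨p, rfl⟩ := (AlgHom.mem_range _).mp ha
  obtain ⟨q, rfl⟩ := (AlgHom.mem_range _).mp hs
  by_cases hs0 : MvPolynomial.aeval (![x, y, z] : Fin 3 → K) q = 0
  · rw [hus, hs0, inv_zero, mul_zero, map_zero]; exact zero_le
  have hs1 : O.valuation (MvPolynomial.aeval (![x, y, z] : Fin 3 → K) q) = 1 := by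
    apply le_antisymm ((O.valuation_le_one_iff _).mpr
      (KC3Upper.aeval_mem_valuationSubring _ O hk (valuation_coord_lt_one hker hW hx) q))
    have h := (O.valuation_le_one_iff _).mpr hsO
    rw [map_inv₀] at h
    exact (inv_le_one₀ (zero_lt_iff.mpr (by rw [Ne, Valuation.zero_iff]; exact hs0))).mp h
  have hprod : u * ⟨_, aeval_mem_loc O q⟩ ∈
      cohomologyAnnihilatorOfDegree ↥(loc O (MvPolynomial.aeval (R := k) (![x, y, z] : Fin 3 → K)).range) n :=
    Ideal.mul_mem_right _ _ hn
  have heq : u * ⟨_, aeval_mem_loc O q⟩ = ⟨MvPolynomial.aeval (![x, y, z] : Fin 3 → K) p, aeval_mem_loc O p⟩ := by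
    apply Subtype.ext
    rw [Subalgebra.coe_mul, hus]
    change _ * MvPolynomial.aeval (![x, y, z] : Fin 3 → K) q = _
    rw [mul_assoc, inv_mul_cancel₀ hs0, mul_one]
  rw [heq] at hprod
  have hmodel := ringEquiv_apply_mem_cohomologyAnnihilatorOfDegree
    (S := Localization.AtPrime (originIdeal k 3) ⧸ Ideal.span {algebraMap (MvPolynomial (Fin 3) k)
      (Localization.AtPrime (originIdeal k 3)) (X 0 ^ 2 * X 1 + X 1 ^ 2 * X 2 + X 2 ^ 2 * X 0)}) e hprod
  rw [he] at hmodel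
  have hp2 := mem_sq_of_mk_algebraMap_mem_cohomologyAnnihilatorOfDegree k (originIdeal k 3) rfl p hmodel
  rw [hus, map_mul, map_inv₀, hs1, inv_one, mul_one]
  exact valuation_aeval_le_of_mem_sq hker hW hx hk hp2

/-- **`g₀ = x² + 2yz` has MINIMAL value on `ca T₀`**: `c·g₀⁻¹ ∈ O` for every `c ∈ ca (loc O A)`. [OURS · W4.4 kill test] -/
theorem mul_inv_mem_of_mem_ca_loc {c : K}
    (hc : c ∈ ca (loc O (MvPolynomial.aeval (R := k) (![x, y, z] : Fin 3 → K)).range)) :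
    c * (x ^ 2 + 2 * y * z)⁻¹ ∈ O := by
  rw [← O.valuation_le_one_iff, map_mul, map_inv₀, valuation_quadric_eq hker hW]
  have h0 : O.valuation x ^ 2 ≠ 0 := pow_ne_zero 2 (by rw [Ne, Valuation.zero_iff]; exact coord_ne_zero hker 0)
  calc O.valuation c * (O.valuation x ^ 2)⁻¹ ≤ O.valuation x ^ 2 * (O.valuation x ^ 2)⁻¹ :=
        mul_le_mul' (valuation_le_of_mem_ca_loc hker hW hx hk hc) le_rfl
    _ = 1 := mul_inv_cancel₀ h0

/-! ## §3 The (E) initial pair at stage 0 -/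

/-- **THE (E) INITIAL PAIR OF THE CUBIC CONE AT STAGE 0 (OURS · W4.4 (R-QH)).** For the cubic cone `A = k[x,y,z] ⊆ K`
(`hker`) and a valuation ring `O ∋ k` centred at the vertex with the weight property (`hW`), the conclusion of the residue
stub `stub_initialPairOfConstantGenus` holds AT STAGE `m' = 0` with `g₀ = x² + 2yz`, `g₁ = y² + 2zx`: both in `ca (tower O A 0)`,
`g₀ ≠ 0` of minimal value on `ca`, `g₁ g₀⁻¹` residually transcendental over `k`. Every field `k`. [OURS · W4.4 kill test] -/
theorem initialPair_cubicCone :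
    (x ^ 2 + 2 * y * z) ∈ ca (tower O (MvPolynomial.aeval (R := k) (![x, y, z] : Fin 3 → K)).range 0) ∧
    (y ^ 2 + 2 * z * x) ∈ ca (tower O (MvPolynomial.aeval (R := k) (![x, y, z] : Fin 3 → K)).range 0) ∧
    (x ^ 2 + 2 * y * z) ≠ 0 ∧
    (∀ c ∈ ca (tower O (MvPolynomial.aeval (R := k) (![x, y, z] : Fin 3 → K)).range 0),
      c * (x ^ 2 + 2 * y * z)⁻¹ ∈ O) ∧
    ∀ P : Polynomial k, P ≠ 0 →
      ¬ O.valuation (Polynomial.aeval ((y ^ 2 + 2 * z * x) * (x ^ 2 + 2 * y * z)⁻¹) P) < 1 := by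
  rw [tower_zero]
  refine ⟨?_, ?_, quadric_ne_zero hker, fun c hc => mul_inv_mem_of_mem_ca_loc hker hW hx hk hc, fun P hP => ?_⟩
  · have h := quadric_mem_ca_loc hker hW hx hk 1
    simpa using h
  · have h := quadric_mem_ca_loc hker hW hx hk 2
    simpa using h
  · rw [valuation_aeval_ratio_eq_one hker hW hP]; exact lt_irrefl 1

/-! ## §4 The exit -/

/-- **THE CUBIC CONE EXITS (OURS · W4.4 (R-QH)).** In the kill test's binders (`p` prime, `CharP k p`, `K = Frac A`,
`dim A = 2`), for the cubic cone (`hker`) and a weight valuation ring `O` (`hk`, `hx`, `hW`): **some stage of the `ca`-tower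
along `O` is regular** — `SurfaceTermination`'s conclusion for this `(A, O)`: `g₁ g₀⁻¹ ∈ chart O T₀ ≤ T₁` is residually
transcendental (LEMMA E in tower form + res-L0-w44's residual criterion). [OURS · W4.4 kill test] -/
theorem exists_isRegularLocalRing_tower_cubicCone (p : ℕ) (hp : p.Prime) [CharP k p]
    (hfr : IsFractionRing ↥(MvPolynomial.aeval (R := k) (![x, y, z] : Fin 3 → K)).range K)
    (hdim : ringKrullDim ↥(MvPolynomial.aeval (R := k) (![x, y, z] : Fin 3 → K)).range = 2) :
    ∃ m : ℕ, IsRegularLocalRing ↥(tower O (MvPolynomial.aeval (R := k) (![x, y, z] : Fin 3 → K)).range m) := by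
  obtain ⟨h₀, h₁, hne, hmin, hval⟩ := initialPair_cubicCone hker hW hx hk
  have hA : (MvPolynomial.aeval (R := k) (![x, y, z] : Fin 3 → K)).range.FG :=
    ⟨(Set.finite_range ![x, y, z]).toFinset, by rw [Set.Finite.coe_toFinset, Algebra.adjoin_range_eq_range_aeval]⟩
  have hAO : (MvPolynomial.aeval (R := k) (![x, y, z] : Fin 3 → K)).range.toSubring ≤ O.toSubring := by
    rintro a ⟨q, rfl⟩
    exact KC3Upper.aeval_mem_valuationSubring _ O hk (valuation_coord_lt_one hker hW hx) q
  have htr : Algebra.trdeg k K ≤ 2 := (Reduction.trdeg_eq_two_of_ringKrullDim_eq_two _ hA hfr hdim).le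
  rw [tower_zero] at h₀ h₁ hmin
  have hchart := NoZeno.SandwichCluster.mul_inv_mem_chart O _ h₁ h₀ hne hmin
  have hsucc : (y ^ 2 + 2 * z * x) * (x ^ 2 + 2 * y * z)⁻¹ ∈
      tower O (MvPolynomial.aeval (R := k) (![x, y, z] : Fin 3 → K)).range (0 + 1) := by
    rw [tower_succ, tower_zero]
    exact NoZeno.SandwichCluster.chart_le_loc_nrm_chart O _ hchart
  exact Regimes.exists_regular_of_residually_transcendental_mem_tower p hp k K O _ hk hA hfr hAO htr hval
    (0 + 1) hsucc

end Cone

end Summit.ResolutionOfSingularities.ResolutionOfSingularities.Theorems.SurfaceTermination.CubicCone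

end
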